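import Summits.KontsevichZagierPeriods.KontsevichZagierPeriods.Theses.FurushoPentagon
import Literature.NumberTheory.Transcendental.DrinfeldAssociatorPentagonProofs
import Literature.NumberTheory.Transcendental.MZVShuffleRegularisationProofs
import Literature.NumberTheory.Transcendental.DrinfeldAssociatorGroupLikeProofs
import Literature.NumberTheory.Transcendental.MZVSimplexRepProofs
import Literature.NumberTheory.Transcendental.AssociatorsPentagonWeightFour
import Literature.NumberTheory.Transcendental.AssociatorsLowDegreeProofs
import Literature.NumberTheory.Transcendental.KZRulesAssociator

/-!
# `PentagonInKZ` (stmt-KontsevichZagierPeriods-11348) — negative knowledge, part 1: vocabulary and the evaluation instance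

Support file for the crux `FurushoPentagon.PentagonInKZ` (cdisprove seat, generation 2; work file
`Cruxes/PentagonInKZ/Disproof.lean`).  The crux (realisation form): for every commutative
`ℚ`-algebra `R`, every realisation `χ : KZ.FormalRep →+ R` of the Kontsevich–Zagier rules
(H1 kills `KZ.relations`, H2 multiplicative for the Fubini product, H3 non-degenerate) and every
assignment `Z` of the simplex classes, the `χ`-valued shuffle-regularised MZV series
`Φ_χ = cruxSeries R χ Z` satisfies Drinfeld's pentagon (`pentagonInKZ_iff`, definitional).

* §2 **The evaluation instance is a theorem.**  At `R = ℝ`, `χ = KZ.eval` and any `Z` agreeing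
  with the simplex classes, `cruxSeries` IS Drinfeld's `Φ_KZ` coefficient by coefficient
  (`cruxSeries_eval_eq_drinfeldAssociator`: the support of `reg_ш(W)` is convergent, and on it
  `eval ∘ Z` is Kontsevich's formula), so the crux's conclusion holds there by Drinfeld's theorem,
  PROVED in the tree (`pentagon_evalInstance` ← `drinfeldAssociator_pentagon_holds`).  Hence the
  crux's sign / word-order / slot-order / regularisation conventions are exactly Drinfeld's in
  every weight, and no counterexample to the crux exists at `χ = eval`: a refutation needs a
  realisation finer than evaluation (part 4, `KernelImplies.lean`, shows it would refute the
  kernel form of Conjecture 1).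
* §3 Tools for parts 2–4: the augmentation `ε : U𝔞₄/(deg>N) → R` (`t_ij ↦ 0`), `c_∅² = c_∅³`
  for every pentagon solution, the forced unit `χ[pt,1] = 1` (H1–H3), and the constant, linear
  and weight-3 coefficients of `Φ_χ`.
[cite: Furusho2003, Prop. 3.2.3; Drinfeld1991, (2.13); Furusho2011, §2]
-/

noncomputable section

open Literature.NumberTheory.Transcendental

namespace Summit.KontsevichZagierPeriods.FurushoPentagon.PentagonInKZNegative

open Summit.KontsevichZagierPeriods.KontsevichZagierPeriods.Theses.FurushoPentagon (PentagonInKZ)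

/-! ## §1 Vocabulary and unfolding -/

/-- The `χ`-valued shuffle-regularised multiple-zeta series of the crux,
`Φ_χ(W) = (-1)^{#X₁(W)} Σ_v reg_ш(W)(v) · χ(Z(index v))`. [cite: Furusho2003, Prop. 3.2.3] -/
def cruxSeries (R : Type) [CommRing R] [Algebra ℚ R] (χ : KZ.FormalRep →+ R)
    (Z : List ℕ → KZ.FormalRep) : NCSeries Bool R :=
  fun W : List Bool => (-1 : R) ^ (W.count true) *
    (MZV.shuffleReg W).sum (fun v a => a • (if MZV.IsConvergentWord v then
      χ (Z (MZV.ofBinaryWord v)) else (0 : R)))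

/-- `Z` agrees with the simplex classes `[KZ.mzvRep u]` on admissible indices. [folklore] -/
def AgreesWithSimplex (Z : List ℕ → KZ.FormalRep) : Prop :=
  ∀ (u : List ℕ) (hu : MZV.IsAdmissible u), Z u = KZ.of (KZ.mzvRep u hu
    (KZ.mzvIntegrand_isSemialgebraicFunOn_holds u) (KZ.mzvIntegrand_integrableOn_holds u hu))

/-- A realisation of the KZ rules: additive, kills the four moves, multiplicative for the Fubini
product, non-degenerate. [cite: KontsevichZagier2001, §1.2] -/
structure IsRealisation (R : Type) [CommRing R] (χ : KZ.FormalRep →+ R) : Prop where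
  rel : ∀ c ∈ KZ.relations, χ c = 0
  mul : ∀ a b : KZ.FormalRep, χ (a * b) = χ a * χ b
  unit : ∃ u : KZ.FormalRep, χ u = 1

/-- **Unfolding of the crux** (definitional). [folklore] -/
theorem pentagonInKZ_iff :
    PentagonInKZ ↔ ∀ (R : Type) [CommRing R] [Algebra ℚ R] (χ : KZ.FormalRep →+ R),
      (∀ c ∈ KZ.relations, χ c = 0) → (∀ a b, χ (a * b) = χ a * χ b) → (∃ u, χ u = 1) →
      ∀ Z : List ℕ → KZ.FormalRep, AgreesWithSimplex Z →
        NCSeries.DrinfeldPentagon (cruxSeries R χ Z) :=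
  Iff.rfl

/-- Bundled form of the unfolding. [folklore] -/
theorem pentagonInKZ_iff' :
    PentagonInKZ ↔ ∀ (R : Type) [CommRing R] [Algebra ℚ R] (χ : KZ.FormalRep →+ R),
      IsRealisation R χ → ∀ Z : List ℕ → KZ.FormalRep, AgreesWithSimplex Z →
        NCSeries.DrinfeldPentagon (cruxSeries R χ Z) := by
  rw [pentagonInKZ_iff]
  exact ⟨fun h R _ _ χ hχ Z hZ => h R χ hχ.rel hχ.mul hχ.unit Z hZ,
    fun h R _ _ χ h1 h2 h3 Z hZ => h R χ ⟨h1, h2, h3⟩ Z hZ⟩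

/-- The canonical assignment: simplex classes on admissible indices, `0` elsewhere. [folklore] -/
def simplexZ : List ℕ → KZ.FormalRep := fun u =>
  if hu : MZV.IsAdmissible u then KZ.of (KZ.mzvRep u hu
    (KZ.mzvIntegrand_isSemialgebraicFunOn_holds u) (KZ.mzvIntegrand_integrableOn_holds u hu)) else 0

/-- `simplexZ` agrees with the simplex classes. [folklore] -/
theorem simplexZ_agrees : AgreesWithSimplex simplexZ := fun u hu => by
  simp [simplexZ, hu]

/-- On the empty index an agreeing `Z` is the unit representation `[pt, 1]`. [folklore] -/
theorem agrees_nil {Z : List ℕ → KZ.FormalRep} (hZ : AgreesWithSimplex Z) :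
    Z [] = KZ.of KZ.IntegralRep.unit := by
  rw [hZ [] MZV.isAdmissible_nil, KZ.mzvRep_nil]
  rfl

/-! ## §2 The evaluation instance of the crux is a theorem (all weights) -/

/-- **At `χ = eval` the crux series IS Drinfeld's `Φ_KZ`**, coefficient by coefficient: the support
of `reg_ш(W)` consists of convergent words (`MZV.isConvergentWord_of_mem_support_shuffleReg`), on
which `Z` is the simplex class and `eval` is Kontsevich's formula (`KZ.mzvRep_value_holds`).
[cite: Furusho2003, Prop. 3.2.3] -/
theorem cruxSeries_eval_eq_drinfeldAssociator {Z : List ℕ → KZ.FormalRep}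
    (hZ : AgreesWithSimplex Z) : cruxSeries ℝ KZ.eval Z = drinfeldAssociator := by
  funext W
  rw [cruxSeries, drinfeldAssociator_apply, MZV.zetaWordSum]
  congr 1
  refine Finsupp.sum_congr fun v hv => ?_
  have hconv := MZV.isConvergentWord_of_mem_support_shuffleReg hv
  rw [if_pos hconv, hZ _ (MZV.isAdmissible_ofBinaryWord_of_isConvergentWord hconv), KZ.eval_of,
    KZ.mzvRep_value_holds, Algebra.smul_def, eq_ratCast]

/-- `eval` kills the relations (soundness of the four moves, proved in the tree). [cite: KontsevichZagier2001, §1.2] -/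
theorem eval_rel : ∀ c ∈ KZ.relations, KZ.eval c = 0 := fun _ hc =>
  KZ.relations_le_ker_eval_holds hc

/-- `eval [pt,1] = 1`. [folklore] -/
theorem eval_of_unit : KZ.eval (KZ.of KZ.IntegralRep.unit) = 1 := by
  rw [KZ.eval_of, KZ.IntegralRep.value_unit]

/-- `eval` is a realisation. [cite: KontsevichZagier2001, §1.2] -/
theorem isRealisation_eval : IsRealisation ℝ KZ.eval :=
  ⟨eval_rel, KZ.eval_mul', ⟨_, eval_of_unit⟩⟩

/-- **The evaluation instance of the crux holds** (`R = ℝ`, `χ = eval`, any agreeing `Z`): it is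
Drinfeld's theorem, proved in the tree (`drinfeldAssociator_pentagon_holds`).  Hence no
counterexample to the crux exists at `χ = eval` in any weight: the crux's sign / order /
regularisation conventions are exactly those of `Φ_KZ`. [cite: Drinfeld1991, (2.13)] -/
theorem pentagon_evalInstance {Z : List ℕ → KZ.FormalRep} (hZ : AgreesWithSimplex Z) :
    NCSeries.DrinfeldPentagon (cruxSeries ℝ KZ.eval Z) := by
  rw [cruxSeries_eval_eq_drinfeldAssociator hZ]
  exact drinfeldAssociator_pentagon_holds

/-! ## §3 Augmentation, `c_∅² = c_∅³`, the unit, constant and linear coefficients -/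

/-- **The augmentation** `ε : U𝔞_ι ⊗ R/(deg > N) → R`, `t_ij ↦ 0` (all defining relations hold
trivially at `t = 0`). [folklore] -/
theorem exists_aug (R : Type) [CommRing R] (ι : Type) (N : ℕ) :
    ∃ ε : DrinfeldKohnoTrunc R ι N →ₐ[R] R, ∀ i j, ε (DrinfeldKohnoTrunc.t R N i j) = 0 := by
  classical
  refine ⟨RingQuot.liftAlgHom R ⟨FreeAlgebra.lift R (fun _ : ι × ι => (0 : R)),
    fun a b hab => ?_⟩, fun i j => ?_⟩
  · cases hab with
    | diag i => simp
    | symm i j => simp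
    | fourTerm i j k _ _ _ => simp
    | locality i j k l _ _ _ _ _ _ => simp
    | trunc g =>
      rw [map_list_prod, map_zero, List.map_ofFn]
      simp [Function.comp_def, List.ofFn_succ]
  · exact (RingQuot.liftAlgHom_mkAlgHom_apply R _ _ _).trans (FreeAlgebra.lift_ι_apply _ _)

/-- Under an algebra map killing both arguments, `φ(a, b)` goes to its constant term. [folklore] -/
theorem algHom_subst₂_eq {R : Type} [CommRing R] {A : Type} [Ring A] [Algebra R A]
    (ε : A →ₐ[R] R) (N : ℕ) (φ : NCSeries Bool R) {a b : A} (ha : ε a = 0) (hb : ε b = 0) :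
    ε (NCSeries.subst₂ N φ a b) = φ [] := by
  rw [NCSeries.subst₂, NCSeries.algHom_evalTrunc]
  have hv : (ε ∘ NCSeries.bsub a b) = fun _ => (0 : R) := by
    funext c; cases c <;> simp [ha, hb]
  rw [hv, NCSeries.evalTrunc]
  rw [Finset.sum_eq_single_of_mem 0 (by simp) ?_]
  · simp
  · intro n _ hn
    obtain ⟨k, rfl⟩ := Nat.exists_eq_succ_of_ne_zero hn
    refine Finset.sum_eq_zero fun f _ => ?_
    simp [List.ofFn_succ]

/-- **`c_∅² = c_∅³` for every solution of the pentagon** (apply the augmentation to the level-`0`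
identity). [folklore] -/
theorem sq_eq_cube_of_pentagon {R : Type} [CommRing R] {φ : NCSeries Bool R}
    (h : NCSeries.DrinfeldPentagon φ) : φ [] * φ [] = φ [] * φ [] * φ [] := by
  obtain ⟨ε, hε⟩ := exists_aug R (Fin 4) 0
  have h0 := congrArg ε (h 0)
  simp only [map_mul] at h0
  have key : ∀ a b : DrinfeldKohnoTrunc R (Fin 4) 0, ε a = 0 → ε b = 0 →
      ε (NCSeries.subst₂ 0 φ a b) = φ [] := fun a b ha hb => algHom_subst₂_eq ε 0 φ ha hb
  rwa [key _ _ (hε 0 1) (by simp [map_add, hε]), key _ _ (by simp [map_add, hε]) (hε 2 3),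
    key _ _ (hε 1 2) (hε 2 3), key _ _ (by simp [map_add, hε]) (by simp [map_add, hε]),
    key _ _ (hε 0 1) (hε 1 2)] at h0

/-- **The unit is forced**: H1 + H2 + H3 give `χ [pt, 1] = 1` (`[pt,1]·u − u ∈ relations`).
[cite: KontsevichZagier2001, §4.1] -/
theorem chi_unit {R : Type} [CommRing R] {χ : KZ.FormalRep →+ R} (hχ : IsRealisation R χ) :
    χ (KZ.of KZ.IntegralRep.unit) = 1 := by
  obtain ⟨u, hu⟩ := hχ.unit
  have h := hχ.rel _ (KZ.of_unit_mul_sub_mem_relations u)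
  rw [map_sub, hχ.mul, hu, mul_one, sub_eq_zero] at h
  exact h

section Coefficients

variable {R : Type} [CommRing R] [Algebra ℚ R] (χ : KZ.FormalRep →+ R) (Z : List ℕ → KZ.FormalRep)

/-- On a convergent word the crux series is the signed class: `Φ_χ(w) = (-1)^{#X₁} χ(Z(index w))`.
[cite: Furusho2003, Prop. 3.2.3 (first bullet)] -/
theorem cruxSeries_of_isConvergentWord {w : List Bool} (hw : MZV.IsConvergentWord w) :
    cruxSeries R χ Z w = (-1 : R) ^ (w.count true) * χ (Z (MZV.ofBinaryWord w)) := by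
  rw [cruxSeries, MZV.shuffleReg_of_isConvergentWord hw, Finsupp.sum_single_index (by simp),
    if_pos hw, one_smul]

/-- Constant term: `Φ_χ(∅) = χ(Z [])`. [folklore] -/
theorem cruxSeries_nil : cruxSeries R χ Z [] = χ (Z []) := by
  rw [cruxSeries_of_isConvergentWord χ Z (Or.inl rfl)]
  simp [MZV.ofBinaryWord, MZV.ofBinaryWordAux]

/-- `Φ_χ(X₀) = 0` (`reg(x) = 0`). [cite: IharaKanekoZagier2006, §3] -/
theorem cruxSeries_x : cruxSeries R χ Z [false] = 0 := by
  simp [cruxSeries, MZV.shuffleReg_x]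

/-- `Φ_χ(X₁) = 0` (`reg(y) = 0`). [cite: IharaKanekoZagier2006, §3] -/
theorem cruxSeries_y : cruxSeries R χ Z [true] = 0 := by
  simp [cruxSeries, MZV.shuffleReg_y]

/-- `Φ_χ(X₀X₀X₁) = -χ(Z [3])`. [cite: Furusho2003, Prop. 3.2.3] -/
theorem cruxSeries_xxy : cruxSeries R χ Z [false, false, true] = -χ (Z [3]) := by
  rw [cruxSeries_of_isConvergentWord χ Z (Or.inr ⟨rfl, rfl⟩)]
  have : MZV.ofBinaryWord [false, false, true] = [3] := by decide
  simp [this]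

/-- `Φ_χ(X₀X₁X₁) = χ(Z [2,1])`. [cite: Furusho2003, Prop. 3.2.3] -/
theorem cruxSeries_xyy : cruxSeries R χ Z [false, true, true] = χ (Z [2, 1]) := by
  rw [cruxSeries_of_isConvergentWord χ Z (Or.inr ⟨rfl, rfl⟩)]
  have : MZV.ofBinaryWord [false, true, true] = [2, 1] := by decide
  simp [this]

/-- With an agreeing `Z` and a realisation `χ`, the constant term is `1`. [folklore] -/
theorem cruxSeries_nil_eq_one (hχ : IsRealisation R χ) (hZ : AgreesWithSimplex Z) :
    cruxSeries R χ Z [] = 1 := by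
  rw [cruxSeries_nil, agrees_nil hZ, chi_unit hχ]

end Coefficients


end Summit.KontsevichZagierPeriods.FurushoPentagon.PentagonInKZNegative
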